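import Literature.Analysis.FluidPDE.TaoCascadeScaleOneRegime
import Literature.Analysis.FluidPDE.TaoCascadeSecondBootstrap
import HarnessLib

/-!
# Tao's cascade ODE, §6.6: Cor. 6.14 with the outputs of Prop. 6.13 attached (the inputs of §6.7)

T. Tao, *Finite time blowup for an averaged three-dimensional Navier–Stokes equation*,
J. Amer. Math. Soc. 29 (2016), 601–674 = arXiv:1402.0290v3, §6.6: "Let `T₂` be the largest time in
`[0, T₁]` such that `∫₀^{T₂} a₁(t)² dt ≤ K^{-1/4}`. Combining Proposition 6.13 with Corollary 6.11 and
using continuity, we conclude Corollary 6.14 … The most important modes for the remainder of the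
analysis are `a₀, b₀, c₀, d₀`, and `a₁`. From (6.45)–(6.48), the energy bounds (6.92)–(6.94), and
Proposition 6.13, we observe the equations of motion (6.129)–(6.133) … in the time interval
`0 ≤ t ≤ T₂`."

This file joins the repaired Prop. 6.13 (`prop613_regime`, `prop613_d_one_lt`, `prop613_smallModes`
of `TaoCascadeScaleOneRegime.lean`) to Cor. 6.14 (`exists_second_bootstrap_time_T1` of
`TaoCascadeSecondBootstrap.lean`, whose hypothesis `h13d` — the forwards-exit exclusion
`|d₁| < ½K^{-10}` under (6.86) — is exactly what Prop. 6.13 supplies): under the union of the explicit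
largeness hypotheses of the two files there is a time `T₂ ∈ [0, T₁]` with (6.86) and the bootstrap
regime `GoodAt` on `[0, T₂]`, the trichotomy (6.126)–(6.128) at `T₂`, the bounds
`ZeroScale.SmallModes K ε 11` of (6.116)–(6.117) on `[0, T₂]` (the input `hsmall` of
`RescaledHypotheses.zeroScale_context`, `TaoCascadeReducedClaimLinks.lean`), and the full list
(6.89)–(6.92) on `[0, T₂]` (`second_bootstrap_small`). Theorems only.

## References

* T. Tao, arXiv:1402.0290v3, §6.6 Prop. 6.13, Cor. 6.14 (6.126)–(6.128), (6.129)–(6.133).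
  [`Tao2016AveragedNS`]
-/

noncomputable section

open Set MeasureTheory intervalIntegral Filter Topology
open Literature.Analysis.ODE

namespace Literature.Analysis.FluidPDE

namespace TaoCascade

section SecondSmall

variable {γ ε₀ K ε C₁ C₂ C₃ : ℝ} {n₀ N : ℤ} {τ : ℤ → ℝ} {Xr : Fin 4 → ℤ → ℝ → ℝ} {Er : ℤ → ℝ → ℝ}

/-- The regime bounds `Ẽ₁ ≤ 1`, `Ẽ₂ ≤ K^{-30}` on `[0, T]` from the bootstrap regime `GoodAt` ((6.93),
(6.94) at `m = 1`). [cite: Tao2016AveragedNS, §6.5 (6.93)–(6.94)] -/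
theorem RescaledHypotheses.energy_one_two_of_goodAt
    (h : RescaledHypotheses γ ε₀ K ε C₁ C₂ C₃ n₀ N τ Xr Er) (hε₀ : 0 < ε₀) (hK : 0 < K) (hN : n₀ ≤ N)
    {T : ℝ} (hgood : ∀ t ∈ Icc 0 T, GoodAt ε₀ K Xr Er t) :
    (∀ t ∈ Icc 0 T, Er 1 t ≤ 1) ∧ (∀ t ∈ Icc 0 T, Er 2 t ≤ (K ^ 30)⁻¹) := by
  have hτ00 : τ (n₀ - N) ≤ 0 := h.tau_init_le hN
  have h0 : (0 : ℝ) < 1 + ε₀ := by linarith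
  constructor
  · intro t ht
    have hd := (hgood t ht).during
    have h0' := h.nonneg_F 0 t (hτ00.trans ht.1)
    linarith
  · intro t ht
    have ha := (hgood t ht).after 1 le_rfl
    have hq : (1 + ε₀) ^ (-(10 : ℝ) * (1 : ℕ)) ≤ 1 :=
      Real.rpow_le_one_of_one_le_of_nonpos (by linarith) (by norm_num)
    have hK30 : 0 ≤ (K ^ 30)⁻¹ := by positivity
    have : Er (1 + (1 : ℕ)) t = Er 2 t := by norm_num
    rw [this] at ha
    calc Er 2 t ≤ (K ^ 30)⁻¹ * (1 + ε₀) ^ (-(10 : ℝ) * (1 : ℕ)) := ha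
      _ ≤ (K ^ 30)⁻¹ * 1 := mul_le_mul_of_nonneg_left hq hK30
      _ = (K ^ 30)⁻¹ := mul_one _

/-- **The forwards-exit exclusion `h13d` of Cor. 6.14, supplied by Prop. 6.13**: under the largeness
hypotheses of `prop613_d_one_lt` and `GoodAt` at time `0` (Lemma 6.8), for every `T ∈ [0, T₁]` with
(6.86) `∫₀ᵀ a₁² ≤ K^{-1/4}` one has `|d₁(T)| < ½K^{-10}`. [cite: Tao2016AveragedNS, §6.6 Prop. 6.13 (6.92), Cor. 6.14] -/
theorem RescaledHypotheses.h13d_of_regime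
    (h : RescaledHypotheses γ ε₀ K ε C₁ C₂ C₃ n₀ N τ Xr Er) (hε₀ : 0 < ε₀) (hε₀1 : ε₀ < 1)
    (hK : 2 ≤ K) (hε : 0 < ε) (hε1 : ε ≤ 1) (hC₁ : 0 ≤ C₁) (hC₃ : 0 ≤ C₃) (hN : n₀ ≤ N)
    (hκ : 36 * Real.sqrt 2 * K * ((K ^ 15)⁻¹ * (1 + ε₀) ^ (-(999 : ℝ) / 100) * C₃ *
      geomConst ε₀ ((248 : ℝ) / 100)) ≤ 1)
    (hKa : 12 * ((K ^ 30)⁻¹ * C₃ * geomConst ε₀ ((747 : ℝ) / 100)) ≤ K ^ (-(1 : ℝ) / 4))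
    (hKc : 48600 * K ^ 10 * Real.exp (-(188 / 100) * K ^ 10) * K ^ (-(1 : ℝ) / 4) *
      (C₃ * geomConst ε₀ ((741 : ℝ) / 100) + 1) ≤ 1)
    (hKd : K ^ (-(1 : ℝ) / 4) * (3 * C₃ * geomConst ε₀ ((245 : ℝ) / 100) + 1100) < 1 / 100)
    (hδ1 : 4 * C₁ * (1 + ε₀) ^ (-(n₀ : ℝ) / 2) *
      (Real.exp 1 * (6 * Real.sqrt 2 * K) * cumEnergyConst ε₀ C₃ * C₃ * geomConst ε₀ ((496 : ℝ) / 100)) ≤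
      ε ^ 2 * Real.exp (-K ^ 10) * K ^ (-(1 : ℝ) / 4))
    (hδ2 : 400 * C₁ * (1 + ε₀) ^ (-(n₀ : ℝ) / 2) ≤ ε ^ 2 * Real.exp (-K ^ 10) * K ^ (-(1 : ℝ) / 4))
    (hKe : Real.exp (3600 * Real.sqrt 2 * (K ^ 14)⁻¹) ≤ 2)
    (hKf : 100 * (54 * Real.sqrt 2 * K ^ (-(1 : ℝ) / 4) * Real.exp (-(94 / 100) * K ^ 10) +
      4 * C₁ * (1 + ε₀) ^ (-(n₀ : ℝ) / 2)) ≤ (K ^ 15)⁻¹)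
    (h0 : GoodAt ε₀ K Xr Er 0) :
    ∀ T ∈ Icc 0 (T1 ε₀ K Xr Er), (∫ t in (0 : ℝ)..T, Xr 0 1 t ^ 2) ≤ K ^ (-(1 : ℝ) / 4) →
      |Xr 3 1 T| < 1 / 2 * (K ^ 10)⁻¹ := by
  intro T hT hint
  have hKpos : 0 < K := by linarith
  have hT1 := T1_mem h0
  have hgood : ∀ t ∈ Icc 0 T, GoodAt ε₀ K Xr Er t := fun t ht =>
    h.goodAt_of_mem_T1 hN h0 ⟨ht.1, ht.2.trans hT.2⟩
  obtain ⟨hE1, hE2⟩ := h.energy_one_two_of_goodAt hε₀ hKpos hN hgood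
  exact h.prop613_d_one_lt hε₀ hε₀1 hK hε hε1 hC₁ hC₃ hN hκ hKa hKc hKd hδ1 hδ2 hKe hKf hT.1
    (hT.2.trans hT1.2) hE1 hE2 hint ⟨hT.1, le_rfl⟩

/-- **Cor. 6.14 with Prop. 6.13 attached (the setting of §6.7).** Under the hypotheses of Prop. 6.5
with `γ ≤ 10⁻⁵` and the explicit largeness hypotheses of Lemma 6.8 / Cor. 6.11
(`10⁸ ≤ ε₀K⁴`, `C₂(1+ε₀)^{-n₀/2}cumEnergyConst ≤ 1/100`) and of the repaired Prop. 6.13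
(`hκ, hKa, hKc, hKd, hδ1, hδ2, hKe, hKf`): there is `T₂ ∈ [0, T₁]` such that (6.86) and `GoodAt` hold on
`[0, T₂]`, the trichotomy (6.126)–(6.128) holds at `T₂`, the bounds (6.116)–(6.117) hold on `[0, T₂]` in
the form `ZeroScale.SmallModes K ε 11`, and (6.89)–(6.92) hold on `[0, T₂]` in the explicit form of
`prop613_regime`. [cite: Tao2016AveragedNS, §6.6 Prop. 6.13, Cor. 6.14] -/
theorem RescaledHypotheses.second_bootstrap_small
    (h : RescaledHypotheses γ ε₀ K ε C₁ C₂ C₃ n₀ N τ Xr Er) (hε₀ : 0 < ε₀) (hε₀1 : ε₀ < 1)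
    (hγ1 : γ ≤ 1 / 10 ^ 5) (hK : 2 ≤ K) (hKε : 10 ^ 8 ≤ ε₀ * K ^ 4) (hε : 0 < ε) (hε1 : ε ≤ 1)
    (hC₁ : 0 ≤ C₁) (hC₂ : 0 ≤ C₂) (hC₃ : 0 ≤ C₃) (hN : n₀ ≤ N)
    (hn : C₂ * (1 + ε₀) ^ (-(n₀ : ℝ) / 2) * cumEnergyConst ε₀ C₃ ≤ 1 / 100)
    (hκ : 36 * Real.sqrt 2 * K * ((K ^ 15)⁻¹ * (1 + ε₀) ^ (-(999 : ℝ) / 100) * C₃ *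
      geomConst ε₀ ((248 : ℝ) / 100)) ≤ 1)
    (hKa : 12 * ((K ^ 30)⁻¹ * C₃ * geomConst ε₀ ((747 : ℝ) / 100)) ≤ K ^ (-(1 : ℝ) / 4))
    (hKc : 48600 * K ^ 10 * Real.exp (-(188 / 100) * K ^ 10) * K ^ (-(1 : ℝ) / 4) *
      (C₃ * geomConst ε₀ ((741 : ℝ) / 100) + 1) ≤ 1)
    (hKd : K ^ (-(1 : ℝ) / 4) * (3 * C₃ * geomConst ε₀ ((245 : ℝ) / 100) + 1100) < 1 / 100)
    (hδ1 : 4 * C₁ * (1 + ε₀) ^ (-(n₀ : ℝ) / 2) *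
      (Real.exp 1 * (6 * Real.sqrt 2 * K) * cumEnergyConst ε₀ C₃ * C₃ * geomConst ε₀ ((496 : ℝ) / 100)) ≤
      ε ^ 2 * Real.exp (-K ^ 10) * K ^ (-(1 : ℝ) / 4))
    (hδ2 : 400 * C₁ * (1 + ε₀) ^ (-(n₀ : ℝ) / 2) ≤ ε ^ 2 * Real.exp (-K ^ 10) * K ^ (-(1 : ℝ) / 4))
    (hKe : Real.exp (3600 * Real.sqrt 2 * (K ^ 14)⁻¹) ≤ 2)
    (hKf : 100 * (54 * Real.sqrt 2 * K ^ (-(1 : ℝ) / 4) * Real.exp (-(94 / 100) * K ^ 10) +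
      4 * C₁ * (1 + ε₀) ^ (-(n₀ : ℝ) / 2)) ≤ (K ^ 15)⁻¹) :
    ∃ T₂ ∈ Icc 0 (T1 ε₀ K Xr Er),
      (∀ t ∈ Icc 0 T₂, (∫ s in (0 : ℝ)..t, Xr 0 1 s ^ 2) ≤ K ^ (-(1 : ℝ) / 4)) ∧
      (∀ t ∈ Icc 0 T₂, GoodAt ε₀ K Xr Er t) ∧
      (Er (-1) T₂ = (K ^ 10)⁻¹ * (1 + ε₀) ^ ((2 : ℝ) / 10) ∨
        (∫ t in (0 : ℝ)..T₂, Xr 0 1 t ^ 2) = K ^ (-(1 : ℝ) / 4) ∨ T₂ = 100) ∧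
      ZeroScale.SmallModes K ε 11 Xr T₂ ∧
      (∀ t ∈ Icc 0 T₂,
        |Xr 1 1 t| ≤ 11 * K ^ (-(1 : ℝ) / 4) * ε ∧
        |Xr 2 1 t| ≤ 9 * K ^ (-(1 : ℝ) / 4) * Real.exp (-(94 / 100) * K ^ 10) * ε ^ 2 ∧
        -(Real.exp (6 / 100 * K ^ 10) * (4 * C₁ * (1 + ε₀) ^ (-(n₀ : ℝ) / 2) *
          (Real.exp 1 * (6 * Real.sqrt 2 * K) * cumEnergyConst ε₀ C₃ * C₃ * geomConst ε₀ ((496 : ℝ) / 100) +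
            100))) ≤ Xr 2 1 t ∧
        |Xr 3 1 t| < 1 / 2 * (K ^ 10)⁻¹) := by
  have hKpos : 0 < K := by linarith
  have g0 := h.goodAt_zero hε₀ hε₀1 hγ1 hK hε hε1 hC₂ hC₃ hN hn
  have hT1 := T1_mem g0
  have h13d := h.h13d_of_regime hε₀ hε₀1 hK hε hε1 hC₁ hC₃ hN hκ hKa hKc hKd hδ1 hδ2 hKe hKf g0
  obtain ⟨T₂, hmem, hint, hgood, hex⟩ :=
    h.exists_second_bootstrap_time_T1 hε₀ hε₀1 hγ1 hKpos hKε hε hε1 hC₂ hC₃ hN hn h13d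
  obtain ⟨hE1, hE2⟩ := h.energy_one_two_of_goodAt hε₀ hKpos hN hgood
  have hT₂0 : 0 ≤ T₂ := hmem.1
  have hT₂ : T₂ ≤ 100 := hmem.2.trans hT1.2
  have hP : ∫ s in (0 : ℝ)..T₂, Xr 0 1 s ^ 2 ≤ K ^ (-(1 : ℝ) / 4) := hint T₂ ⟨hT₂0, le_rfl⟩
  refine ⟨T₂, hmem, hint, hgood, hex, ?_, ?_⟩
  · exact h.prop613_smallModes hε₀ hε₀1 (by linarith) hε hε1 hC₁ hC₃ hN hκ hKa hKc hKd hδ1 hδ2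
      hT₂0 hT₂ hE1 hE2 hP
  · intro t ht
    obtain ⟨hb, hc, hcl, -⟩ := h.prop613_regime hε₀ hε₀1 (by linarith) hε hε1 hC₁ hC₃ hN hκ hKa hKc
      hKd hδ1 hδ2 hT₂0 hT₂ hE1 hE2 hP ht
    have hd := h.prop613_d_one_lt hε₀ hε₀1 hK hε hε1 hC₁ hC₃ hN hκ hKa hKc hKd hδ1 hδ2 hKe hKf hT₂0
      hT₂ hE1 hE2 hP ht
    exact ⟨hb, hc, hcl, hd⟩

end SecondSmall

end TaoCascade

end Literature.Analysis.FluidPDE
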